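import Summits.CriticalPhenomena.Ising3D.Control2DConjectureCC
import Summits.CriticalPhenomena.Ising3D.Control2DL19TwoSided099
import Mathlib.Tactic.NormNum
import HarnessLib

/-!
# C-C typed ledger, Λ = 19 rung: `0.99 < Δ_ε < 1.00005` at `Δ_σ = 1/8` under `A2D′` for every window
(cell `pub-ising3x`, seat controls-1 gen 20; typing order T-1 follow-up — CONTROL-ONLY)

HONEST FRAMING: lottery ticket; floor = tightest certified 3D Ising CFT bounds; no exact-solution
claim without a proof. CONTROL-ONLY (`d = 2`, `Δ_σ = 1/8`, axiom set `A2D′`); nothing about `d = 3`.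

`Control2DConjectureCC` (controls-1 g19, p354720) typed the cell-internal law C-C as an evidence LEDGER of kernel
theorems at Λ = 15 (`CCLedger`, proved) and an UNASSERTED limit clause `CCLimit` (`@[conjecture]`). This file adds the
Λ = 19 rung of the ledger — the reader-certified 2D statement of record now kernel-complete
(`twoSided_2d_kernel099`, `Control2DL19TwoSided099`: the Λ = 19 / E₀ = 48 gap certificate `j129766` and the boxes
`j135119`, `j136729`, `j141725` on top of the Λ ≤ 15 cover, every inequality re-decided by `decide +kernel`):
* `CCLedgerL19 : Prop` — `∀ w, TwoSided (1/8) 2 1 w (99/100) (20001/20000)`; `ccLedgerL19_holds` proves it;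
* `ccLedgerL19_of_ccLimit` — it is the `εlo = 99/100`, `U = 20001/20000` instance of the limit clause;
* `ccLedger_of_ccLedgerL19` — the Λ = 19 rung implies clause (c) of the Λ = 15 ledger (monotonicity of `TwoSided`
  in `εlo` and `U`), so the ledger is a chain, not a list.
No facts, nothing asserted beyond kernel theorems; standard axioms only.
-/

namespace Summit.CriticalPhenomena.Ising3D.Control2D

open Literature.MathematicalPhysics.QuantumFieldTheory.ConformalBootstrap3D

/-- **C-C evidence ledger, Λ = 19 rung.** At `Δσ = 1/8` under `A2D′` (`G = 2`, `δ = 1`), derivative order `Λ = 19`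
(`E₀ = 48`): `99/100 < Δε < 20001/20000` for EVERY window parameter `w` — the reader-certified RB-7 statement
(`cover_v15.json`) as a kernel theorem. -/
def CCLedgerL19 : Prop :=
  ∀ w : ℝ, TwoSided (1 / 8 : ℝ) 2 1 w (99 / 100) (20001 / 20000)

/-- The Λ = 19 rung HOLDS: `twoSided_2d_kernel099` (`Control2DL19TwoSided099`; axioms standard). -/
theorem ccLedgerL19_holds : CCLedgerL19 :=
  twoSided_2d_kernel099

/-- The Λ = 19 rung is the `εlo = 99/100`, `U = 20001/20000` instance of the (unasserted) limit clause `CCLimit`. -/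
theorem ccLedgerL19_of_ccLimit (h : CCLimit) : CCLedgerL19 :=
  fun w => h _ _ (by norm_num) (by norm_num) w

/-- Monotonicity of the class-1 statement in its two edges: a tighter two-sided window implies a looser one. -/
theorem twoSided_mono {s G δ w εlo εlo' U U' : ℝ} (h : TwoSided s G δ w εlo U) (hlo : εlo' ≤ εlo)
    (hUU : U ≤ U') : TwoSided s G δ w εlo' U' := by
  intro D hD hC hT x hwx hS
  obtain ⟨h1, h2⟩ := h D hD hC hT x hwx hS
  exact ⟨lt_of_le_of_lt hlo h1, lt_of_lt_of_le h2 hUU⟩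

/-- The Λ = 19 rung implies clause (c) of the Λ = 15 ledger (`39/40 < Δε < 10001/10000` for every window). -/
theorem ccLedger_c_of_ccLedgerL19 (h : CCLedgerL19) (w : ℝ) :
    TwoSided (1 / 8 : ℝ) 2 1 w (39 / 40) (10001 / 10000) :=
  twoSided_mono (h w) (by norm_num) (by norm_num)

end Summit.CriticalPhenomena.Ising3D.Control2D
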